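import Mathlib
import Summits.ValiantsHypothesis.ValiantsHypothesis.Theorems.NewtonUnitEquationsTwoProductsPlanarCellTwoRank
import HarnessLib

/-!
# Crux `TwoProducts` (stmt-ValiantsHypothesis-5906), planar cells in the DISSOCIATED regime: at most `2^m` visible points
# per cell, uniformly in the sparsity (two letters per factor)

Theory lane (val-lit-p3 g13, NOTE §14.1; desk GO RULING #168 (a)).  Let the tails `u_j, v_j` be supported in sets `A_j ∌ 0`
such that the sum map `a ↦ Σ_j a_j` is INJECTIVE on `∏_j (A_j ∪ {0})` (per-factor dissociation, as in `DissociatedUniform` /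
`DissociatedFixedK`).  Then in ONE weight-order cell the visible points of `supp D` number at most `2^m` — independently of `t`
and of `#A_j` (`planarCell_dissociated`).

Proof (TWO LETTERS PER FACTOR, the `m`-uniform rank step that survives planar-side).  Every support point of
`W = ∏(1+u_j) − ∏(1+v_j)` is `Σ_j a_j` for a unique `a ∈ ∏ (A_j ∪ {0})`, with coefficient `∏ û_j(a_j) − ∏ v̂_j(a_j)`
(`û_j(0) = 1`, `û_j(e) = u_j[e]`; `coeff_prodOneAdd`).  Fix a factor `j` and two visible points `l_p, l_q` of the cell whose
`j`-th letters `p ≠ q` satisfy `p ≽ q` in the cell order (single letters compare uniformly across the cell; `0` is on top).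
Swapping the `j`-th letter of `l_q` for `p` gives a point that outweighs `l_q` for `l_q`'s witness, hence is NOT in `supp W`
(strict top), while its coefficient is `û_j(p)·PF_{i≠j} û_i − v̂_j(p)·PF_{i≠j} v̂_i = ⟨φ p, ψ q⟩` with `φ p, ψ q ∈ ℂ²`.  So the
pairing is triangular with nonzero diagonal (`⟨φ p, ψ p⟩ = W[l_p] ≠ 0`), the `φ p` are linearly independent in `ℂ²`
(`linearIndependent_of_triangular_le`), at most TWO letters occur in slot `j`, and a visible point is determined by its letters:
`#S ≤ 2^m`.  Only ONE-letter swaps are used — sums of two or more letters do not compare uniformly across a cell, which is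
why the lifted multi-slot argument has no planar transplant (NOTE §13) while this one does.

Honest framing: the dissociated regime of the crux is already in the tree by other routes (`DissociatedFixedK`, p5907; the
dissociated engine of line corner-log-linearization); this file places it INSIDE the cell architecture with the optimal
per-cell constant `2^m` and isolates additive coincidences of the factor supports as the entire remaining difficulty of
`PlanarCellBound`.  `PlanarCross`, `PlanarCellBound`, the engine and the crux `TwoProducts` are OPEN; `VP ≠ VNP` is NOT
proved.  No named facts. [folklore]
-/

noncomputable section

-- Sub = Summit single-conjunct layout: the duplicated namespace component is mandated by the tree.
set_option linter.dupNamespace false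

open scoped BigOperators
open MvPolynomial
open Summit.ValiantsHypothesis.ValiantsHypothesis.Theorems.NewtonUnitEquations.TwoProducts.FormalLogLinearisation

namespace Summit.ValiantsHypothesis.ValiantsHypothesis.Theorems.NewtonUnitEquations.TwoProducts.PlanarCell

/-- **Triangular pairing with a non-strict key ⇒ linear independence.**  If `⟨φ x, ψ y⟩ = 0` whenever `x ≠ y` and
`key y ≤ key x`, and `⟨φ x, ψ x⟩ ≠ 0`, then the `φ x` are linearly independent (ties in the key allowed). [folklore] -/
theorem linearIndependent_of_triangular_le {ι : Type*} [Fintype ι] {n : ℕ} (key : ι → ℝ)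
    (φ ψ : ι → (Fin n → ℂ)) (h0 : ∀ x y, x ≠ y → key y ≤ key x → φ x ⬝ᵥ ψ y = 0) (h1 : ∀ x, φ x ⬝ᵥ ψ x ≠ 0) :
    LinearIndependent ℂ φ := by
  classical
  rw [Fintype.linearIndependent_iff]
  intro c hc
  by_contra hne
  obtain ⟨x₀, hx₀⟩ := not_forall.1 hne
  obtain ⟨xm, hxm, hmin⟩ := Finset.exists_min_image (Finset.univ.filter fun x => c x ≠ 0) key
    ⟨x₀, Finset.mem_filter.2 ⟨Finset.mem_univ _, hx₀⟩⟩
  have hcm : c xm ≠ 0 := (Finset.mem_filter.1 hxm).2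
  have hsum : (∑ x, c x • φ x) ⬝ᵥ ψ xm = 0 := by rw [hc]; exact zero_dotProduct _
  rw [sum_dotProduct, Finset.sum_eq_single xm] at hsum
  · rw [smul_dotProduct, smul_eq_mul] at hsum
    exact (mul_ne_zero hcm (h1 xm)) hsum
  · intro x _ hx
    by_cases hcx : c x = 0
    · simp [hcx]
    · rw [smul_dotProduct, h0 x xm hx (hmin x (Finset.mem_filter.2 ⟨Finset.mem_univ _, hcx⟩)), smul_zero]
  · intro h; exact absurd (Finset.mem_univ xm) h

/-! ## Products of `1 + (sparse)` over dissociated supports -/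

/-- Coefficient of a tail extended by `1` at the exponent `0`: `ŵ(0) = 1`, `ŵ(e) = w[e]`. [folklore] -/
def hatCoeff (w : MvPolynomial (Fin 2) ℂ) (e : Expo) : ℂ := if e = 0 then 1 else coeff e w

/-- `1 + w = Σ_{e ∈ A ∪ {0}} ŵ(e) X^e` for a tail `w` supported in `A ∌ 0`. [folklore] -/
theorem one_add_eq_sum_hatCoeff (w : MvPolynomial (Fin 2) ℂ) (A : Finset Expo) (h0 : (0 : Expo) ∉ A)
    (hw : w.support ⊆ A) : 1 + w = ∑ e ∈ insert 0 A, monomial e (hatCoeff w e) := by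
  classical
  rw [Finset.sum_insert h0]
  have h1 : (monomial (0 : Expo) (hatCoeff w 0) : MvPolynomial (Fin 2) ℂ) = 1 := by simp [hatCoeff]
  rw [h1]
  congr 1
  have hsum : ∑ e ∈ A, monomial e (hatCoeff w e) = ∑ e ∈ A, monomial e (coeff e w) := by
    refine Finset.sum_congr rfl fun e he => ?_
    have hne : e ≠ 0 := fun h => h0 (h ▸ he)
    simp [hatCoeff, hne]
  rw [hsum, ← Finset.sum_subset hw]
  · exact w.as_sum
  · intro e _ he
    rw [notMem_support_iff.1 he, map_zero]

variable {m : ℕ}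

/-- **Product expansion.**  `∏_j (1 + w_j) = Σ_{a ∈ ∏ (A_j ∪ {0})} (∏_j ŵ_j(a_j)) X^{Σ_j a_j}`. [folklore] -/
theorem prod_one_add_eq (w : Fin m → MvPolynomial (Fin 2) ℂ) (A : Fin m → Finset Expo)
    (h0 : ∀ j, (0 : Expo) ∉ A j) (hw : ∀ j, (w j).support ⊆ A j) :
    ∏ j, (1 + w j) = ∑ a ∈ Fintype.piFinset (fun j => insert 0 (A j)),
      monomial (∑ j, a j) (∏ j, hatCoeff (w j) (a j)) := by
  classical
  have h : ∏ j, (1 + w j) = ∏ j, ∑ e ∈ insert 0 (A j), monomial e (hatCoeff (w j) e) :=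
    Finset.prod_congr rfl fun j _ => one_add_eq_sum_hatCoeff (w j) (A j) (h0 j) (hw j)
  rw [h, Finset.prod_univ_sum]
  refine Finset.sum_congr rfl fun a _ => ?_
  rw [monomial_sum_prod]

/-- **Coefficients under dissociation.**  If the sum map is injective on `∏ (A_j ∪ {0})`, the coefficient of
`∏_j (1 + w_j)` at `Σ_j a_j` is `∏_j ŵ_j(a_j)`. [folklore] -/
theorem coeff_prod_one_add_of_mem (w : Fin m → MvPolynomial (Fin 2) ℂ) (A : Fin m → Finset Expo)
    (h0 : ∀ j, (0 : Expo) ∉ A j) (hw : ∀ j, (w j).support ⊆ A j)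
    (hdis : Set.InjOn (fun a : Fin m → Expo => ∑ j, a j) ↑(Fintype.piFinset (fun j => insert 0 (A j))))
    {a : Fin m → Expo} (ha : a ∈ Fintype.piFinset (fun j => insert 0 (A j))) :
    coeff (∑ j, a j) (∏ j, (1 + w j)) = ∏ j, hatCoeff (w j) (a j) := by
  classical
  rw [prod_one_add_eq w A h0 hw, coeff_sum]
  simp only [coeff_monomial]
  rw [Finset.sum_eq_single_of_mem a ha]
  · simp
  · intro b hb hne
    rw [if_neg]
    intro heq
    exact hne (hdis hb ha heq)

/-- Off the image of the sum map the coefficients of `∏_j (1 + w_j)` vanish. [folklore] -/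
theorem coeff_prod_one_add_eq_zero (w : Fin m → MvPolynomial (Fin 2) ℂ) (A : Fin m → Finset Expo)
    (h0 : ∀ j, (0 : Expo) ∉ A j) (hw : ∀ j, (w j).support ⊆ A j) {p : Expo}
    (hp : ∀ a ∈ Fintype.piFinset (fun j => insert 0 (A j)), ∑ j, a j ≠ p) :
    coeff p (∏ j, (1 + w j)) = 0 := by
  classical
  rw [prod_one_add_eq w A h0 hw, coeff_sum]
  simp only [coeff_monomial]
  exact Finset.sum_eq_zero fun a ha => if_neg (hp a ha)

/-- Updating one letter: `∏_i ŵ_i((a[j ↦ p])_i) = ŵ_j(p) · ∏_{i ≠ j} ŵ_i(a_i)`. [folklore] -/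
theorem prod_hatCoeff_update (w : Fin m → MvPolynomial (Fin 2) ℂ) (a : Fin m → Expo) (j : Fin m) (p : Expo) :
    ∏ i, hatCoeff (w i) (Function.update a j p i) =
      hatCoeff (w j) p * ∏ i ∈ Finset.univ.erase j, hatCoeff (w i) (a i) := by
  classical
  rw [← Finset.mul_prod_erase _ _ (Finset.mem_univ j), Function.update_self]
  congr 1
  refine Finset.prod_congr rfl fun i hi => ?_
  rw [Function.update_of_ne (Finset.ne_of_mem_erase hi)]

/-- Sum of an updated tuple: `Σ_i (a[j ↦ p])_i = p + Σ_{i ≠ j} a_i`. [folklore] -/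
theorem sum_update_eq (a : Fin m → Expo) (j : Fin m) (p : Expo) :
    ∑ i, Function.update a j p i = p + ∑ i ∈ Finset.univ.erase j, a i := by
  classical
  rw [← Finset.add_sum_erase _ _ (Finset.mem_univ j), Function.update_self]
  congr 1
  refine Finset.sum_congr rfl fun i hi => ?_
  rw [Function.update_of_ne (Finset.ne_of_mem_erase hi)]

/-! ## The dissociated cell bound -/

/-- **DISSOCIATED ⇒ AT MOST `2^m` VISIBLE POINTS PER CELL (t-free).**  Tails `u_j, v_j` supported in `A_j ∌ 0` with the
sum map injective on `∏_j (A_j ∪ {0})`; then every cell family `S` (log-visible points with valid witnesses inducing one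
relation `R` on the tail support) has `#S ≤ 2^m`: each factor contributes at most two letters. [folklore] -/
theorem planarCell_dissociated (u v : Fin m → MvPolynomial (Fin 2) ℂ) (A : Fin m → Finset Expo)
    (hA0 : ∀ j, (0 : Expo) ∉ A j) (huA : ∀ j, (u j).support ⊆ A j) (hvA : ∀ j, (v j).support ⊆ A j)
    (hdis : Set.InjOn (fun a : Fin m → Expo => ∑ j, a j) ↑(Fintype.piFinset (fun j => insert 0 (A j))))
    (R : Expo → Expo → Prop) (S : Finset Expo)
    (hS : ∀ l ∈ S, ∃ ξ : Fin 2 → ℝ, ValidWeight u v ξ ∧ IsStrictTop ξ (logSupport u v) l ∧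
      ∀ e ∈ tailSupport u v, ∀ e' ∈ tailSupport u v, (R e e' ↔ wt ξ e ≤ wt ξ e')) :
    S.card ≤ 2 ^ m := by
  set PF := Fintype.piFinset (fun j => insert (0 : Expo) (A j)) with hPF
  set T := tailSupport u v with hT
  have hu0 : ∀ j, coeff 0 (u j) = 0 := fun j => notMem_support_iff.1 fun h => hA0 j (huA j h)
  have hv0 : ∀ j, coeff 0 (v j) = 0 := fun j => notMem_support_iff.1 fun h => hA0 j (hvA j h)
  rcases S.eq_empty_or_nonempty with hS0 | ⟨l₀, hl₀⟩
  · simp [hS0]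
  obtain ⟨ζ, hζval, -, hRζ⟩ := hS l₀ hl₀
  choose! ξ hval htop hRξ using hS
  have htopW : ∀ l ∈ S, IsStrictTop (ξ l) ↑(tailDiff u v).support l := fun l hl =>
    (stub_logLinearisation m u v hu0 hv0 (ξ l) (hval l hl) l).2 (htop l hl)
  have hsupp : ∀ l ∈ S, l ∈ (tailDiff u v).support := fun l hl => (htopW l hl).1
  -- coefficients of `W` on the image of the sum map, and vanishing off it
  have hW : tailDiff u v = ∏ j, (1 + u j) - ∏ j, (1 + v j) := rfl
  have hcoeffW : ∀ a ∈ PF, coeff (∑ j, a j) (tailDiff u v) =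
      ∏ j, hatCoeff (u j) (a j) - ∏ j, hatCoeff (v j) (a j) := by
    intro a ha
    rw [hW, coeff_sub, coeff_prod_one_add_of_mem u A hA0 huA hdis ha, coeff_prod_one_add_of_mem v A hA0 hvA hdis ha]
  have hcoeffW0 : ∀ p : Expo, (∀ a ∈ PF, ∑ j, a j ≠ p) → coeff p (tailDiff u v) = 0 := by
    intro p hp
    rw [hW, coeff_sub, coeff_prod_one_add_eq_zero u A hA0 huA hp, coeff_prod_one_add_eq_zero v A hA0 hvA hp, sub_zero]
  -- representatives of the visible points
  have hrep : ∀ l ∈ S, ∃ a ∈ PF, ∑ j, a j = l := by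
    intro l hl
    by_contra h
    exact (mem_support_iff.1 (hsupp l hl)) (hcoeffW0 l fun a ha heq => h ⟨a, ha, heq⟩)
  choose! rep hrepPF hrepsum using hrep
  -- letters of visible points are `0` or tail exponents
  have hT_of : ∀ (w : Fin m → MvPolynomial (Fin 2) ℂ) (i : Fin m) (e : Expo), (w = u ∨ w = v) →
      hatCoeff (w i) e ≠ 0 → e = 0 ∨ e ∈ T := by
    intro w i e hw hne
    by_cases he : e = 0
    · exact Or.inl he
    · right
      simp only [hatCoeff, he, if_false] at hne
      have hmem : e ∈ (w i).support := mem_support_iff.2 hne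
      rcases hw with rfl | rfl
      · exact Finset.mem_union_left _ (Finset.mem_biUnion.2 ⟨i, Finset.mem_univ _, hmem⟩)
      · exact Finset.mem_union_right _ (Finset.mem_biUnion.2 ⟨i, Finset.mem_univ _, hmem⟩)
  have hletter : ∀ l ∈ S, ∀ i, rep l i = 0 ∨ rep l i ∈ T := by
    intro l hl i
    have hne : coeff l (tailDiff u v) ≠ 0 := mem_support_iff.1 (hsupp l hl)
    rw [← hrepsum l hl, hcoeffW _ (hrepPF l hl)] at hne
    by_cases hu : ∏ j, hatCoeff (u j) (rep l j) = 0
    · rw [hu, zero_sub, neg_ne_zero] at hne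
      exact hT_of v i _ (Or.inr rfl) (Finset.prod_ne_zero_iff.1 hne i (Finset.mem_univ _))
    · exact hT_of u i _ (Or.inl rfl) (Finset.prod_ne_zero_iff.1 hu i (Finset.mem_univ _))
  -- comparisons of letters transfer from `ζ` to every witness, `0` on top
  have hwt0 : ∀ (η : Fin 2 → ℝ), wt η 0 = 0 := fun η => by simp [wt]
  have hval_neg : ∀ l ∈ S, ∀ e ∈ T, wt (ξ l) e < 0 := by
    intro l hl e he
    rcases Finset.mem_union.1 he with h | h
    · obtain ⟨j, -, hj⟩ := Finset.mem_biUnion.1 h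
      exact (hval l hl).1 j e hj
    · obtain ⟨j, -, hj⟩ := Finset.mem_biUnion.1 h
      exact (hval l hl).2 j e hj
  have hζ_neg : ∀ e ∈ T, wt ζ e < 0 := by
    intro e he
    rcases Finset.mem_union.1 he with h | h
    · obtain ⟨j, -, hj⟩ := Finset.mem_biUnion.1 h
      exact hζval.1 j e hj
    · obtain ⟨j, -, hj⟩ := Finset.mem_biUnion.1 h
      exact hζval.2 j e hj
  have transfer : ∀ l ∈ S, ∀ p q : Expo, (p = 0 ∨ p ∈ T) → (q = 0 ∨ q ∈ T) →
      wt ζ q ≤ wt ζ p → wt (ξ l) q ≤ wt (ξ l) p := by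
    intro l hl p q hp hq hle
    rcases hp with rfl | hp
    · rcases hq with rfl | hq
      · exact le_rfl
      · rw [hwt0]; exact (hval_neg l hl q hq).le
    · rcases hq with rfl | hq
      · exfalso
        rw [hwt0] at hle
        linarith [hζ_neg p hp]
      · exact (hRξ l hl q hq p hp).1 ((hRζ q hq p hp).2 hle)
  -- for each factor, at most two letters
  have hslot : ∀ j : Fin m, (S.image fun l => rep l j).card ≤ 2 := by
    intro j
    set P := S.image fun l => rep l j with hP
    -- a visible point carrying each letter
    have hcarrier : ∀ p ∈ P, ∃ l ∈ S, rep l j = p := fun p hp => by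
      simpa only [hP, Finset.mem_image] using hp
    choose! car hcarS hcarj using hcarrier
    let key : ↥P → ℝ := fun p => wt ζ (p : Expo)
    let φ : ↥P → (Fin 2 → ℂ) := fun p => ![hatCoeff (u j) p, -hatCoeff (v j) p]
    let ψ : ↥P → (Fin 2 → ℂ) := fun q =>
      ![∏ i ∈ Finset.univ.erase j, hatCoeff (u i) (rep (car q) i),
        ∏ i ∈ Finset.univ.erase j, hatCoeff (v i) (rep (car q) i)]
    -- updating the `j`-th letter of a carrier by its own letter does nothing
    have hupd : ∀ q ∈ P, Function.update (rep (car q)) j q = rep (car q) := by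
      intro q hq
      funext i
      by_cases hi : i = j
      · subst hi
        rw [Function.update_self]
        exact (hcarj q hq).symm
      · rw [Function.update_of_ne hi]
    -- the pairing is the coefficient of `W` at the swapped point
    have hpair : ∀ p q : ↥P, φ p ⬝ᵥ ψ q =
        coeff (∑ i, Function.update (rep (car q)) j (p : Expo) i) (tailDiff u v) := by
      intro p q
      have hq := q.2
      have hmemPF : Function.update (rep (car q)) j (p : Expo) ∈ PF := by
        rw [hPF, Fintype.mem_piFinset]
        intro i
        by_cases hi : i = j
        · subst hi
          rw [Function.update_self]
          obtain ⟨l, hl, hlj⟩ := Finset.mem_image.1 p.2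
          have := Fintype.mem_piFinset.1 (hPF ▸ hrepPF l hl) i
          rwa [hlj] at this
        · rw [Function.update_of_ne hi]
          exact Fintype.mem_piFinset.1 (hPF ▸ hrepPF (car q) (hcarS q hq)) i
      rw [hcoeffW _ hmemPF, prod_hatCoeff_update, prod_hatCoeff_update]
      simp [φ, ψ, dotProduct, Fin.sum_univ_two]
      ring
    have h1 : ∀ p : ↥P, φ p ⬝ᵥ ψ p ≠ 0 := by
      intro p
      have hp := p.2
      rw [hpair, hupd p hp, hrepsum (car p) (hcarS p hp)]
      exact mem_support_iff.1 (hsupp (car p) (hcarS p hp))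
    have h0 : ∀ p q : ↥P, p ≠ q → key q ≤ key p → φ p ⬝ᵥ ψ q = 0 := by
      intro p q hne hle
      have hp := p.2; have hq := q.2
      rw [hpair]
      set c := ∑ i, Function.update (rep (car q)) j (p : Expo) i with hc
      -- `c` outweighs `car q` for the witness of `car q`
      have hlq : (car q : Expo) = (q : Expo) + ∑ i ∈ Finset.univ.erase j, rep (car q) i := by
        have := sum_update_eq (rep (car q)) j (q : Expo)
        rwa [hupd q hq, hrepsum (car q) (hcarS q hq)] at this
      have hcsum : c = (p : Expo) + ∑ i ∈ Finset.univ.erase j, rep (car q) i := sum_update_eq _ _ _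
      have hpT : (p : Expo) = 0 ∨ (p : Expo) ∈ T := by
        obtain ⟨l, hl, hlj⟩ := Finset.mem_image.1 hp
        rw [← hlj]; exact hletter l hl j
      have hqT : (q : Expo) = 0 ∨ (q : Expo) ∈ T := by
        rw [← hcarj q hq]; exact hletter (car q) (hcarS q hq) j
      have hge : wt (ξ (car q)) (car q) ≤ wt (ξ (car q)) c := by
        have e1 : wt (ξ (car q)) (car q) =
            wt (ξ (car q)) (q : Expo) + wt (ξ (car q)) (∑ i ∈ Finset.univ.erase j, rep (car q) i) :=
          (congrArg (wt (ξ (car q))) hlq).trans (wt_add _ _ _)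
        have e2 : wt (ξ (car q)) c =
            wt (ξ (car q)) (p : Expo) + wt (ξ (car q)) (∑ i ∈ Finset.univ.erase j, rep (car q) i) := by
          rw [hcsum, wt_add]
        rw [e1, e2]
        have := transfer (car q) (hcarS q hq) p q hpT hqT hle
        linarith
      have hcne : c ≠ car q := by
        intro heq
        have h1 : Function.update (rep (car q)) j (p : Expo) ∈ PF := by
          rw [hPF, Fintype.mem_piFinset]
          intro i
          by_cases hi : i = j
          · subst hi
            rw [Function.update_self]
            obtain ⟨l, hl, hlj⟩ := Finset.mem_image.1 hp
            have := Fintype.mem_piFinset.1 (hPF ▸ hrepPF l hl) i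
            rwa [hlj] at this
          · rw [Function.update_of_ne hi]
            exact Fintype.mem_piFinset.1 (hPF ▸ hrepPF (car q) (hcarS q hq)) i
        have h2 : ∑ i, Function.update (rep (car q)) j (p : Expo) i = ∑ i, rep (car q) i := by
          rw [← hc, heq, hrepsum (car q) (hcarS q hq)]
        have h3 := hdis h1 (hrepPF (car q) (hcarS q hq)) h2
        have h4 := congrFun h3 j
        rw [Function.update_self, hcarj q hq] at h4
        exact hne (Subtype.ext h4)
      by_contra hcoeff
      have hmem : c ∈ ((tailDiff u v).support : Set Expo) := mem_support_iff.2 hcoeff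
      have hlt := (htopW (car q) (hcarS q hq)).2 c hmem hcne
      linarith
    have hLI : LinearIndependent ℂ φ := linearIndependent_of_triangular_le key φ ψ h0 h1
    have h := hLI.fintype_card_le_finrank
    rw [Module.finrank_fin_fun, Fintype.card_coe] at h
    exact h
  -- a visible point is determined by its letters
  have hinj : Set.InjOn rep ↑S := fun l hl l' hl' h => by
    rw [← hrepsum l hl, ← hrepsum l' hl', h]
  have hsub : ∀ l ∈ S, rep l ∈ Fintype.piFinset (fun j => S.image fun l => rep l j) := fun l hl =>
    Fintype.mem_piFinset.2 fun j => Finset.mem_image.2 ⟨l, hl, rfl⟩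
  calc S.card ≤ (Fintype.piFinset (fun j => S.image fun l => rep l j)).card :=
        Finset.card_le_card_of_injOn rep hsub hinj
    _ = ∏ j, (S.image fun l => rep l j).card := Fintype.card_piFinset _
    _ ≤ ∏ _j : Fin m, 2 := Finset.prod_le_prod' fun j _ => hslot j
    _ = 2 ^ m := by simp

end Summit.ValiantsHypothesis.ValiantsHypothesis.Theorems.NewtonUnitEquations.TwoProducts.PlanarCell

end
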